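import Summits.CriticalPhenomena.PercolationContinuityZ3.Theorems.PercNearOneGluingNoHeavyLowerTailGZPendantHub
import HarnessLib

/-!
# `NoHeavyLowerTail` (stmt-CriticalPhenomena-4575) — support file: the WHEATSTONE BRIDGE with one hub edge satisfies the
# logarithmic covariance bound (prover `prim-ineq-prove-2` gen 13; MEMO-22 §3)

No definitions, no named facts, no sorries.  The Wheatstone bridge `W = {av, au, vu, vb, bu}` (terminals `a, b`, internal
vertices `u, v`) is the first two-terminal graph that is NOT series–parallel, so THEOREM SP (`GZSP.sp_cov_le`) does not
cover `W` with a hub edge `uc`.  Read with `u` as the hub vertex, however, `W` IS a series–parallel hub network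
(`GZPendantHub.bridge_isSPNet`: `(av; hub edges au, vu)` in series at `v` with `(vb; hub edge bu)`), so the pendant-hub
theorem `GZPendantHub.pendant_cov_le` yields the bound for `W ∪ {uc}` with hub `c`, for every weight of `uc`
(`GZPendantHub.bridge_pendant_cov_le`).
-/

noncomputable section

namespace Summit.CriticalPhenomena.PercolationContinuityZ3.Theorems

namespace GZPendantHub

open MeasureTheory Literature.Probability.LatticeModels Literature.Probability.Percolation
open scoped Classical

variable {V : Type*}

/-- The Wheatstone bridge `{av, au, vu} ∪ {vb, bu}` with terminals `a, b`, read with `u` as the hub vertex, is a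
two-terminal series–parallel hub network (`(av; hubs au, vu)` in series at `v` with `(vb; hub bu)`). [folklore] -/
theorem bridge_isSPNet {a b u v : V} (hab : a ≠ b) (hau : a ≠ u) (hav : a ≠ v) (hbu : b ≠ u) (hbv : b ≠ v)
    (huv : u ≠ v) :
    GZSP.IsSPNet u (insert s(v, u) (insert s(a, u) {s(a, v)}) ∪ insert s(b, u) {s(v, b)}) a b := by
  have h₀ : GZSP.IsSPNet u ({s(a, v)} : Finset (Sym2 V)) a v := GZSP.IsSPNet.edge hav hau huv.symm
  have h₀' : GZSP.IsSPNet u (insert s(a, u) ({s(a, v)} : Finset (Sym2 V))) a v := by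
    refine GZSP.IsSPNet.hubLeft h₀ ?_
    simp [huv, hau.symm]
  have h₁ : GZSP.IsSPNet u (insert s(v, u) (insert s(a, u) ({s(a, v)} : Finset (Sym2 V)))) a v := by
    refine GZSP.IsSPNet.hubRight h₀' ?_
    simp [huv, huv.symm, hau.symm, hav.symm]
  have h₂₀ : GZSP.IsSPNet u ({s(v, b)} : Finset (Sym2 V)) v b := GZSP.IsSPNet.edge hbv.symm huv.symm hbu
  have h₂ : GZSP.IsSPNet u (insert s(b, u) ({s(v, b)} : Finset (Sym2 V))) v b := by
    refine GZSP.IsSPNet.hubRight h₂₀ ?_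
    simp [huv, hbu.symm, hbv]
  refine GZSP.IsSPNet.series h₁ h₂ ?_ ?_ ?_ ?_
  · rw [Finset.disjoint_left]
    intro e he
    simp only [Finset.mem_insert, Finset.mem_singleton] at he ⊢
    rcases he with rfl | rfl | rfl <;>
      simp [hab, hau, hav, hbu.symm, hbv.symm, huv, huv.symm]
  · rintro z ⟨e, he, hz⟩ ⟨f, hf, hzf⟩
    simp only [Finset.mem_insert, Finset.mem_singleton] at he hf
    rcases he with rfl | rfl | rfl <;> rcases hf with rfl | rfl <;>
      simp only [Sym2.mem_iff] at hz hzf <;>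
      rcases hz with rfl | rfl <;> rcases hzf with h | h <;>
      simp_all
  · intro e he
    simp only [Finset.mem_insert, Finset.mem_singleton] at he
    rcases he with rfl | rfl <;> simp [Sym2.mem_iff, hab, hau, hav]
  · intro e he
    simp only [Finset.mem_insert, Finset.mem_singleton] at he
    rcases he with rfl | rfl | rfl <;> simp [Sym2.mem_iff, hab.symm, hbu, hbv]

variable [Fintype V]

/-- **The Wheatstone bridge with one hub edge satisfies the logarithmic covariance bound.**  For pairwise distinct
vertices `a, b` (terminals), `c` (hub), `u, v`, let `E' = ({av, au, vu} ∪ {vb, bu}) ∪ {uc}` — the Wheatstone bridge on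
`a, u, v, b` plus ONE hub edge at the internal vertex `u` — with independent weights, those of the five bridge edges in
`(0, 1)` and that of `uc` arbitrary.  Then (events read on `ω ∩ E'`)
`P(a↮c, b↮c) − P(a↮c)·P(b↮c) ≤ P(ab|c) · log (P(a ↔ b off c) / P(ab|c))`, i.e.
`Cov(1{a↔c}, 1{b↔c}) ≤ P(ab|c)·log(P(a ↔_{G−c} b)/P(ab|c))` — an instance of the Gladkov–Zimin Conj. 6.3 / Gladkov
Conj. 10.1 bound (with modulus `w log(1/w)`) whose `a–b` core off the hub is the bridge, NOT series–parallel.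
MEMO-22 §3. [folklore; this work] -/
theorem bridge_pendant_cov_le (w : Sym2 V → unitInterval) {a b c u v : V} (hab : a ≠ b) (hac : a ≠ c) (hau : a ≠ u)
    (hav : a ≠ v) (hbc : b ≠ c) (hbu : b ≠ u) (hbv : b ≠ v) (hcu : c ≠ u) (hcv : c ≠ v) (huv : u ≠ v)
    (hw : ∀ e ∈ (insert s(v, u) (insert s(a, u) {s(a, v)}) ∪ insert s(b, u) {s(v, b)} : Finset (Sym2 V)),
      0 < (w e : ℝ) ∧ (w e : ℝ) < 1) :
    (prodBernoulli w).real ({ω : Set (Sym2 V) | ¬(openGraph (ω ∩ (↑(insert s(u, c) ((insert s(v, u) (insert s(a, u) {s(a, v)}) ∪ insert s(b, u) {s(v, b)} : Finset (Sym2 V)))) : Set (Sym2 V)))).Reachable a c} ∩ {ω : Set (Sym2 V) | ¬(openGraph (ω ∩ (↑(insert s(u, c) ((insert s(v, u) (insert s(a, u) {s(a, v)}) ∪ insert s(b, u) {s(v, b)} : Finset (Sym2 V)))) : Set (Sym2 V)))).Reachable b c}) -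
        (prodBernoulli w).real {ω : Set (Sym2 V) | ¬(openGraph (ω ∩ (↑(insert s(u, c) ((insert s(v, u) (insert s(a, u) {s(a, v)}) ∪ insert s(b, u) {s(v, b)} : Finset (Sym2 V)))) : Set (Sym2 V)))).Reachable a c} *
          (prodBernoulli w).real {ω : Set (Sym2 V) | ¬(openGraph (ω ∩ (↑(insert s(u, c) ((insert s(v, u) (insert s(a, u) {s(a, v)}) ∪ insert s(b, u) {s(v, b)} : Finset (Sym2 V)))) : Set (Sym2 V)))).Reachable b c} ≤
      ((prodBernoulli w).real ({ω : Set (Sym2 V) | ¬(openGraph (ω ∩ (↑(insert s(u, c) ((insert s(v, u) (insert s(a, u) {s(a, v)}) ∪ insert s(b, u) {s(v, b)} : Finset (Sym2 V)))) : Set (Sym2 V)))).Reachable a c} ∩ {ω : Set (Sym2 V) | ¬(openGraph (ω ∩ (↑(insert s(u, c) ((insert s(v, u) (insert s(a, u) {s(a, v)}) ∪ insert s(b, u) {s(v, b)} : Finset (Sym2 V)))) : Set (Sym2 V)))).Reachable b c}) -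
          (prodBernoulli w).real ({ω : Set (Sym2 V) | ¬(openGraph (ω ∩ (↑(insert s(u, c) ((insert s(v, u) (insert s(a, u) {s(a, v)}) ∪ insert s(b, u) {s(v, b)} : Finset (Sym2 V)))) : Set (Sym2 V)))).Reachable a b} ∩ {ω : Set (Sym2 V) | ¬(openGraph (ω ∩ (↑(insert s(u, c) ((insert s(v, u) (insert s(a, u) {s(a, v)}) ∪ insert s(b, u) {s(v, b)} : Finset (Sym2 V)))) : Set (Sym2 V)))).Reachable a c} ∩ {ω : Set (Sym2 V) | ¬(openGraph (ω ∩ (↑(insert s(u, c) ((insert s(v, u) (insert s(a, u) {s(a, v)}) ∪ insert s(b, u) {s(v, b)} : Finset (Sym2 V)))) : Set (Sym2 V)))).Reachable b c})) *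
        Real.log ((prodBernoulli w).real {ω : Set (Sym2 V) | (openGraph ((ω ∩ (↑(insert s(u, c) ((insert s(v, u) (insert s(a, u) {s(a, v)}) ∪ insert s(b, u) {s(v, b)} : Finset (Sym2 V)))) : Set (Sym2 V))) \ {e : Sym2 V | c ∈ e})).Reachable a b} /
          ((prodBernoulli w).real ({ω : Set (Sym2 V) | ¬(openGraph (ω ∩ (↑(insert s(u, c) ((insert s(v, u) (insert s(a, u) {s(a, v)}) ∪ insert s(b, u) {s(v, b)} : Finset (Sym2 V)))) : Set (Sym2 V)))).Reachable a c} ∩ {ω : Set (Sym2 V) | ¬(openGraph (ω ∩ (↑(insert s(u, c) ((insert s(v, u) (insert s(a, u) {s(a, v)}) ∪ insert s(b, u) {s(v, b)} : Finset (Sym2 V)))) : Set (Sym2 V)))).Reachable b c}) -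
            (prodBernoulli w).real ({ω : Set (Sym2 V) | ¬(openGraph (ω ∩ (↑(insert s(u, c) ((insert s(v, u) (insert s(a, u) {s(a, v)}) ∪ insert s(b, u) {s(v, b)} : Finset (Sym2 V)))) : Set (Sym2 V)))).Reachable a b} ∩ {ω : Set (Sym2 V) | ¬(openGraph (ω ∩ (↑(insert s(u, c) ((insert s(v, u) (insert s(a, u) {s(a, v)}) ∪ insert s(b, u) {s(v, b)} : Finset (Sym2 V)))) : Set (Sym2 V)))).Reachable a c} ∩ {ω : Set (Sym2 V) | ¬(openGraph (ω ∩ (↑(insert s(u, c) ((insert s(v, u) (insert s(a, u) {s(a, v)}) ∪ insert s(b, u) {s(v, b)} : Finset (Sym2 V)))) : Set (Sym2 V)))).Reachable b c}))) := by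
  have hcE : ∀ e ∈ (insert s(v, u) (insert s(a, u) {s(a, v)}) ∪ insert s(b, u) {s(v, b)} : Finset (Sym2 V)), c ∉ e := by
    intro e he
    simp only [Finset.mem_union, Finset.mem_insert, Finset.mem_singleton] at he
    rcases he with (rfl | rfl | rfl) | (rfl | rfl) <;>
      simp [Sym2.mem_iff, hcv, hcu, hac.symm, hbc.symm]
  have key := pendant_cov_le w (bridge_isSPNet hab hau hav hbu hbv huv) hcE hac hbc hcu.symm hw
  exact key

end GZPendantHub

end Summit.CriticalPhenomena.PercolationContinuityZ3.Theorems
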